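import Literature.IUT.HodgeTheaters.TemperedCoveringsFiniteGraph
import Literature.AnabelianGeometry.SemiGraphs.Corollary27iConsequences
import HarnessLib

/-!
# [IUTchI] Prop. 2.2 for FINITE dual semi-graphs with ALL FOUR cited [SemiAnbd] inputs supplied by kernel theorems

Mochizuki, *Inter-universal Teichmüller theory I*, kurims manuscript (May 2020), §2, Proposition 2.2
pp. 45–46 [cite: Mochizuki2012, Prop 2.2 p.45] (D-0012 claim key; series status DISPUTED; nothing of the
series is asserted here); Mochizuki, *Semi-graphs of anabelioids* (2006), Thm. 3.7 (i)/(iii) pp. 40–41,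
Prop. 3.6 (iii) p. 38, Cor. 2.7 (i) p. 30 [cite: MochizukiSemiAnbd2006, Thm 3.7(iii) pp.40-41].

PROOF-ONLY sequel of `TemperedCoveringsFiniteGraph.lean` (abc-iut cell; seat abc-iut-L3-d1, item L5g): the
finite-graph closer `prop22_byName_of_finiteGraph` there discharges the three [SemiAnbd] §3 named inputs of
[IUTchI] Prop. 2.2 AS TYPED (Thm. 3.7 (iii) = abc-iut-L3-t8's `compactInVerticialAt_of_finiteGraph`,
Thm. 3.7 (i) = `verticialInjective_holds`, Galois domination = abc-iut-L3-t7's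
`galoisDomination_of_prop36`) but still binds the fourth cited input `hHatH`
(«C_{Π̂_𝔾}(Π̂_ℍ) = Π̂_ℍ», print p. 46 l. 9–11 «by the evident pro-Σ̂ analogue of [SemiAnbd], Corollary
2.7, (i)»).  Since [SemiAnbd] Cor. 2.7 (i) is now the kernel theorem `corollary_2_7_i_holds`
(abc-iut-w4-d071, `Corollary27iHoldsViaDecompositionGroups.lean`), abc-iut-w4-d071's
`TemperedGraphGroupData.hatH_commTerminal` (`Corollary27iConsequences.lean`) produces `hHatH` from the
AGREEMENT datum `eHat`/`hrange` (abstract `Π̂_𝔾` of the interface vs `π₁(B(𝒢))`, the cusp-omission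
atoms of p. 44: abc-iut-w5-d028's G-w5d028-1 disposition (i)) alone.  The one theorem below composes the
two: **[IUTchI] Prop. 2.2 AS TYPED (`CommensuratorsOfDecompositionSubgroups`, all four clauses) for a
finite dual semi-graph with EVERY cited [SemiAnbd] input — Thm. 3.7 (iii), Thm. 3.7 (i), Prop. 3.6 (iii)
Galois domination, Cor. 2.7 (i) — supplied by kernel theorems**; the remaining binders are the structural
identifications of the data (charts, `IsProfiniteCompletion`, verticial families, node data with
[NodNon] `VerticialIntersectionNear`, closedness of `Π̂_ℍ`) and the agreement datum with its p. 44 atoms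
(`hq` quasi-coherence of the cusp-omitted graph, `hel` elevation of the vertices of `K`).  One-line
composition; nothing restated; originals untouched.  Typed ≠ proved for the [IUTchI] node itself; nothing
here bears on [IUTchIII] Cor. 3.12.
-/

namespace Literature.IUT.HodgeTheaters

open CategoryTheory CategoryTheory.PreGaloisCategory
open Pointwise Filter
open _root_.Topology
open Literature.AnabelianGeometry.SemiGraphs (IsTempered IsProfiniteCompletion PSCDatum ProfiniteSemiGraph
  SemiGraphOfAnabelioids)
open Literature.AnabelianGeometry.SemiGraphs.ProfiniteSemiGraph (TemperedPiChart verticialSubgroups)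
open Literature.AnabelianGeometry.AbsoluteAnabelian (IsCommensurablyTerminal)

universe v₁ u₁ u' u

namespace TemperedGraphGroupData

variable (D : TemperedGraphGroupData.{u}) {𝒢 𝒢H : ProfiniteSemiGraph.{u}}

/-- **[IUTchI] Prop. 2.2 AS TYPED for FINITE dual semi-graphs, all four cited [SemiAnbd] inputs supplied by
kernel theorems** (Thm. 3.7 (iii) at finite `𝔾`, Thm. 3.7 (i), Galois domination, and Cor. 2.7 (i) for
`hHatH` via the agreement datum `eHat`/`hrange` and the p. 44 cusp-omission atoms `hq`/`hel`).
[cite: Mochizuki2012, Prop 2.2 p.45] -/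
theorem prop22_byName_of_finiteGraph_of_agreement [T2Space D.Tp] [Finite 𝒢.graph.Vertex]
    [Finite 𝒢.graph.Edge] [Finite 𝒢H.graph.Vertex] [Finite 𝒢H.graph.Edge]
    (hcH : IsClosed (D.HatH : Set D.Hat))
    (c : TemperedPiChart 𝒢) (e : D.Tp ≃ₜ* c.G) (h𝒢 : 𝒢.Thm37Hypotheses)
    (hPC : IsProfiniteCompletion
      ({ toMonoidHom := D.ι, continuous_toFun := D.ι_continuous } : D.Tp →ₜ* D.Hat))
    (G : PSCDatum D.Hat) (hNN : G.VerticialIntersectionNear) (σ : 𝒢.graph.Vertex ≃ G.graph.V)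
    (Λv : G.graph.V → Subgroup D.Tp)
    (hvert : ∀ v : 𝒢.graph.Vertex, (Λv (σ v)).map (e : D.Tp →* c.G) ∈ verticialSubgroups c v)
    (hΛv : ∀ v, (Λv v).map D.ι = G.vertGp v)
    (src tgt : G.graph.N → G.graph.V) (c₁ c₂ : G.graph.N → D.Tp)
    (hends : ∀ e, G.graph.nodeEnds e = s(src e, tgt e))
    (h₁ : ∀ e, G.nodeGp e ≤ MulAut.conj (D.ι (c₁ e)) • G.vertGp (src e))
    (h₂ : ∀ e, G.nodeGp e ≤ MulAut.conj (D.ι (c₂ e)) • G.vertGp (tgt e))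
    (hloop : ∀ e, src e = tgt e → (c₁ e)⁻¹ * c₂ e ∉ Λv (src e))
    (cH : TemperedPiChart 𝒢H) (eH : (D.restrictH hcH).Tp ≃ₜ* cH.G) (h𝒢H : 𝒢H.Thm37Hypotheses)
    (hPCH : IsProfiniteCompletion
      ({ toMonoidHom := (D.restrictH hcH).ι, continuous_toFun := (D.restrictH hcH).ι_continuous } :
        (D.restrictH hcH).Tp →ₜ* (D.restrictH hcH).Hat))
    (GH : PSCDatum (D.restrictH hcH).Hat) (hNNH : GH.VerticialIntersectionNear)
    (σH : 𝒢H.graph.Vertex ≃ GH.graph.V)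
    (ΛvH : GH.graph.V → Subgroup (D.restrictH hcH).Tp)
    (hvertH : ∀ v : 𝒢H.graph.Vertex,
      (ΛvH (σH v)).map (eH : (D.restrictH hcH).Tp →* cH.G) ∈ verticialSubgroups cH v)
    (hΛvH : ∀ v, (ΛvH v).map (D.restrictH hcH).ι = GH.vertGp v)
    (srcH tgtH : GH.graph.N → GH.graph.V) (c₁H c₂H : GH.graph.N → (D.restrictH hcH).Tp)
    (hendsH : ∀ e, GH.graph.nodeEnds e = s(srcH e, tgtH e))
    (h₁H : ∀ e, GH.nodeGp e ≤ MulAut.conj ((D.restrictH hcH).ι (c₁H e)) • GH.vertGp (srcH e))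
    (h₂H : ∀ e, GH.nodeGp e ≤ MulAut.conj ((D.restrictH hcH).ι (c₂H e)) • GH.vertGp (tgtH e))
    (hloopH : ∀ e, srcH e = tgtH e → (c₁H e)⁻¹ * c₂H e ∉ ΛvH (srcH e))
    -- the agreement datum for `hHatH` (abc-iut-w5-d028 / w4-d071): `Π̂_𝔾 ≅ π₁(B(𝒢'))` carrying `Π̂_ℍ` onto `Π_K`
    {𝒢a : SemiGraphOfAnabelioids.{v₁, u₁, u'}} (h𝒢a : 𝒢a.IsConnected)
    (hq : (𝒢a.restrict 𝒢a.graph.maximalSubgraph).IsQuasiCoherent)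
    (K : 𝒢a.graph.Subgraph) (hK : K.toSemiGraph.IsConnected) (w : K.toSemiGraph.Vertex)
    (hel : ∀ v : K.toSemiGraph.Vertex, (𝒢a.restrict 𝒢a.graph.maximalSubgraph).IsElevated ⟨v.1, trivial⟩)
    (F : 𝒢a.V w.1 ⥤ FintypeCat.{v₁}) [FiberFunctor F]
    (eHat : D.Hat ≃* 𝒢a.Pi w.1 F) (hrange : D.HatH.map eHat.toMonoidHom = (𝒢a.piHToPi K w F).range) :
    D.CommensuratorsOfDecompositionSubgroups :=
  D.prop22_byName_of_finiteGraph hcH c e h𝒢 hPC G hNN σ Λv hvert hΛv src tgt c₁ c₂ hends h₁ h₂ hloop cH eH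
    h𝒢H hPCH GH hNNH σH ΛvH hvertH hΛvH srcH tgtH c₁H c₂H hendsH h₁H h₂H hloopH
    (D.hatH_commTerminal h𝒢a hq K hK w hel F eHat hrange)

end TemperedGraphGroupData

end Literature.IUT.HodgeTheaters
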